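import Mathlib
import Summits.SmoothPoincare4.SmoothPoincare4.Theses.SullivanDual
import Summits.SmoothPoincare4.SmoothPoincare4.Theorems.SullivanDualAdmissibleJExists
import Summits.SmoothPoincare4.SmoothPoincare4.Theorems.SullivanDualWitnessChargeStubCollarChart
import Literature.Geometry.Symplectic.JHolomorphicMap
import Literature.Analysis.Complex.PlancherelPolyaProofs
import HarnessLib

/-!
# Crux `HyperbolicEnd` (stmt-SmoothPoincare4-7825), line `Sketch` — stub `stub_collarLiouville`

**Collar Liouville / bubble confinement.** Let `M` be a `C^∞` `4`-manifold, `p ∈ M`,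
`e = extChartAt (𝓡 4) p`, `ι` the inversion of `ℝ⁴ ∖ 0`, and let `J` be a field of tangent
endomorphisms of `M ∖ {p}` which is STANDARD on the punctured chart-ball `B_ε'` at `p`:
`⟪A (J v), b⟫ = ω₀(A v, b)` with `A = Dι(e x − e p) ∘ De_x`, i.e. `A ∘ J = J₀ ∘ A` there; assume
`closedBall (e p) ε' ⊆ e.target`. Then, GIVEN the flat Liouville theorem for bounded continuous
locally sub-mean-value functions on `ℂ` (hypothesis `hL`, the neighbouring stub
`stub_subMeanValueLiouville`), every non-constant `C^∞` `J`-holomorphic `u : ℂ → M ∖ {p}` whose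
image avoids some punctured chart-ball `B_η` avoids all of `B_ε'`.

Proof. On the open set `Ω = u⁻¹(B_ε')` the map `W = ι(e u − e p) : Ω → ℝ⁴` is `J₀`-holomorphic
(chain rule and standardness), so its complex coordinates `g₁ = W₀ + i W₁`, `g₂ = W₂ + i W₃` are
holomorphic on `Ω`; `ε'⁻² < ‖W‖² ≤ η⁻²` on `Ω` and `‖W‖² = ε'⁻²` on `∂Ω` (the chart piece over the
closed ball is closed in `M ∖ {p}`). Hence `s = ‖W‖²` on `Ω`, `s = ε'⁻²` off `Ω`, is continuous,
bounded, `≥ ε'⁻²`, and locally sub-mean-value (`|g_k|²` is sub-mean-value on small circles inside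
`Ω`; off `Ω`, `s` attains its minimum). By `hL` it is constant, so `Ω ≠ ∅` forces `Ω = ℂ`; then
`g₁, g₂` are bounded entire functions, constant by Liouville, `W` is constant, `e ∘ u` is
constant and `u` is constant — a contradiction. So `Ω = ∅`.
-/

noncomputable section

-- the prescribed crux namespace repeats the component `SmoothPoincare4`
set_option linter.dupNamespace false

open scoped Manifold ContDiff Topology
open Laplacian Set
open Literature.Geometry.Symplectic Literature.Topology.FourManifolds
open Summit.SmoothPoincare4.SmoothPoincare4.Theorems.SullivanDual
open Summit.SmoothPoincare4.SmoothPoincare4.Theorems.WitnessCharge.PencilIncompleteness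

namespace Summit.SmoothPoincare4.SmoothPoincare4.Cruxes.HyperbolicEnd.Sketch

/-! ### Flat helpers on `ℝ⁴ = ℂ²` -/

/-- A pair of coordinates of `ℝ⁴`, read as one complex number, is a continuous `ℝ`-linear map
`ℝ⁴ → ℂ`. -/
theorem exists_clm_coordPair (i j : Fin 4) :
    ∃ π : EuclideanSpace ℝ (Fin 4) →L[ℝ] ℂ, ∀ a : EuclideanSpace ℝ (Fin 4), π a = ⟨a i, a j⟩ := by
  refine ⟨(Complex.equivRealProdCLM.symm : ℝ × ℝ →L[ℝ] ℂ).comp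
    ((EuclideanSpace.proj i).prod (EuclideanSpace.proj j)), fun a => ?_⟩
  apply Complex.ext <;> simp

/-- `‖a‖² = |a₀ + i a₁|² + |a₂ + i a₃|²` on `ℝ⁴ = ℂ²`. -/
theorem norm_sq_eq_coordPair (a : EuclideanSpace ℝ (Fin 4)) :
    ‖a‖ ^ 2 = ‖(⟨a 0, a 1⟩ : ℂ)‖ ^ 2 + ‖(⟨a 2, a 3⟩ : ℂ)‖ ^ 2 := by
  rw [EuclideanSpace.norm_sq_eq, Fin.sum_univ_four, Complex.sq_norm, Complex.sq_norm,
    Complex.normSq_mk, Complex.normSq_mk]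
  simp only [Real.norm_eq_abs, sq_abs]
  ring

/-- The first complex coordinate intertwines `J₀` with multiplication by `i`. -/
theorem coordPair_stdComplexStructure_zero_one (a : EuclideanSpace ℝ (Fin 4)) :
    (⟨stdComplexStructure a 0, stdComplexStructure a 1⟩ : ℂ) = Complex.I * ⟨a 0, a 1⟩ := by
  apply Complex.ext <;> simp

/-- The second complex coordinate intertwines `J₀` with multiplication by `i`. -/
theorem coordPair_stdComplexStructure_two_three (a : EuclideanSpace ℝ (Fin 4)) :
    (⟨stdComplexStructure a 2, stdComplexStructure a 3⟩ : ℂ) = Complex.I * ⟨a 2, a 3⟩ := by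
  apply Complex.ext <;> simp

/-- A real-differentiable `g : ℂ → ℂ` whose derivative commutes with `i` is complex
differentiable (the derivative is the restriction of scalars of a `ℂ`-linear map). -/
theorem differentiableAt_complex_of_hasFDerivAt {g : ℂ → ℂ} {L : ℂ →L[ℝ] ℂ} {z : ℂ}
    (hg : HasFDerivAt g L z) (hL : ∀ ζ : ℂ, L (Complex.I * ζ) = Complex.I * L ζ) :
    DifferentiableAt ℂ g z := by
  rw [differentiableAt_iff_restrictScalars ℝ hg.differentiableAt, hg.fderiv]
  exact exists_restrictScalars_eq_of_map_mul_I L fun ζ => by rw [hL, smul_eq_mul]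

/-- **Sub-mean-value property of `|g|²`** on circles, for `g` analytic on the closed disc
(the case `p = 2` of the tree's `norm_rpow_le_circleAverage`). -/
theorem norm_sq_le_circleAverage {g : ℂ → ℂ} {c : ℂ} {R : ℝ} (hR : 0 < R)
    (hg : AnalyticOnNhd ℂ g (Metric.closedBall c R)) :
    ‖g c‖ ^ 2 ≤ Real.circleAverage (fun z => ‖g z‖ ^ 2) c R := by
  have h := Literature.Analysis.Complex.norm_rpow_le_circleAverage (p := 2) two_pos hR hg
  simpa only [Real.rpow_two] using h


/-- `ω₀` pins `J₀`: if `⟪w, b⟫ = ω₀(a, b)` for every `b`, then `w = J₀ a`. -/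
theorem eq_stdComplexStructure_of_forall_inner_eq {w a : EuclideanSpace ℝ (Fin 4)}
    (h : ∀ b, inner ℝ w b = stdSymplecticForm a b) : w = stdComplexStructure a := by
  refine ext_inner_right ℝ fun b => ?_
  rw [h b, inner_stdComplexStructure_eq_stdSymplecticForm]

/-! ### The inverted chart along a curve -/

section Manifold

variable {M : Type*} [TopologicalSpace M] [T2Space M] [ChartedSpace (EuclideanSpace ℝ (Fin 4)) M]

/-- **Boundary behaviour.** If the closed `ε'`-ball about `e p` lies in the chart target and
`u : ℂ → M ∖ {p}` is continuous, then at every frontier point `z` of `Ω = u⁻¹(B_ε')` the point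
`u z` lies over the chart source and `‖e (u z) − e p‖ = ε'` (the chart piece over the closed
ball is closed in `M ∖ {p}` and contains `Ω`, hence its closure). -/
theorem norm_extChartAt_sub_eq_of_mem_frontier (p : M) {ε' : ℝ}
    (hball : Metric.closedBall (extChartAt (𝓡 4) p p) ε' ⊆ (extChartAt (𝓡 4) p).target)
    {u : ℂ → punctured p} (hu : Continuous u) {z : ℂ}
    (hz : z ∈ frontier {w : ℂ | InPuncturedChartBall p ε' (u w)}) :
    (u z).1 ∈ (chartAt (EuclideanSpace ℝ (Fin 4)) p).source ∧
      ‖extChartAt (𝓡 4) p (u z).1 - extChartAt (𝓡 4) p p‖ = ε' := by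
  have hΩo : IsOpen {w : ℂ | InPuncturedChartBall p ε' (u w)} :=
    (isOpen_setOf_inPuncturedChartBall p ε').preimage hu
  rw [hΩo.frontier_eq] at hz
  obtain ⟨hzc, hzΩ⟩ := hz
  have hC : IsClosed {w : ℂ | (u w).1 ∈ (chartAt (EuclideanSpace ℝ (Fin 4)) p).source ∧
      extChartAt (𝓡 4) p (u w).1 ∈ Metric.closedBall (extChartAt (𝓡 4) p p) ε'} :=
    (isClosed_setOf_extChartAt_mem p (isCompact_closedBall _ _) hball).preimage hu
  have hsub : {w : ℂ | InPuncturedChartBall p ε' (u w)} ⊆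
      {w : ℂ | (u w).1 ∈ (chartAt (EuclideanSpace ℝ (Fin 4)) p).source ∧
        extChartAt (𝓡 4) p (u w).1 ∈ Metric.closedBall (extChartAt (𝓡 4) p p) ε'} :=
    fun w hw => ⟨hw.1, Metric.ball_subset_closedBall hw.2⟩
  obtain ⟨hsrc, hcl⟩ := closure_minimal hsub hC hzc
  refine ⟨hsrc, le_antisymm ?_ ?_⟩
  · rw [← dist_eq_norm]
    exact Metric.mem_closedBall.1 hcl
  · by_contra hlt
    push Not at hlt
    exact hzΩ ⟨hsrc, Metric.mem_ball.2 (by rwa [dist_eq_norm])⟩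

variable [IsManifold (𝓡 4) ∞ M]

/-- **Chain rule along a curve.** For `u : ℂ → M ∖ {p}` differentiable at `z` with `u z` over
the chart source, `W = ι(e u − e p)` has Fréchet derivative `Dι(e(u z) − e p) ∘ De_{u z} ∘ du_z`
at `z`. -/
theorem hasFDerivAt_inversion_extChartAt_curve (p : M) {u : ℂ → punctured p} {z : ℂ}
    (hu : MDifferentiableAt 𝓘(ℝ, ℂ) (𝓡 4) u z)
    (hz : (u z).1 ∈ (chartAt (EuclideanSpace ℝ (Fin 4)) p).source) :
    HasFDerivAt
      (fun w : ℂ => inversion (extChartAt (𝓡 4) p (u w).1 - extChartAt (𝓡 4) p p))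
      (((fderiv ℝ inversion (extChartAt (𝓡 4) p (u z).1 - extChartAt (𝓡 4) p p)).comp
          (mfderiv (𝓡 4) 𝓘(ℝ, EuclideanSpace ℝ (Fin 4))
            (fun y : punctured p => extChartAt (𝓡 4) p y.1) (u z))).comp
        (mfderiv 𝓘(ℝ, ℂ) (𝓡 4) u z)) z :=
  hasMFDerivAt_iff_hasFDerivAt.mp
    ((hasMFDerivAt_inversion_extChartAt_sub p (u z) hz).comp z hu.hasMFDerivAt)

/-- **`W = ι(e u − e p)` is `J₀`-holomorphic where `J` is standard.** If `J` is standard on the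
punctured `ε'`-ball (`⟪A (J v), b⟫ = ω₀(A v, b)`, i.e. `A ∘ J = J₀ ∘ A`), `u` is `J`-holomorphic
and `u z ∈ B_ε'`, then `dW_z(iζ) = A du_z(iζ) = A J du_z ζ = J₀ dW_z ζ`, so every complex
coordinate `π ∘ W` (`π J₀ = i π`) is complex differentiable at `z`. -/
theorem differentiableAt_coordPair_inversion_extChartAt_curve (p : M)
    {J : ∀ x : punctured p, TangentSpace (𝓡 4) x →L[ℝ] TangentSpace (𝓡 4) x} {ε' : ℝ}
    (hJstd : ∀ x : punctured p, InPuncturedChartBall p ε' x →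
      ∀ (v : TangentSpace (𝓡 4) x) (b : EuclideanSpace ℝ (Fin 4)),
        inner ℝ (fderiv ℝ inversion (extChartAt (𝓡 4) p x.1 - extChartAt (𝓡 4) p p)
          (mfderiv (𝓡 4) 𝓘(ℝ, EuclideanSpace ℝ (Fin 4))
            (fun z : punctured p => extChartAt (𝓡 4) p z.1) x (J x v))) b
        = stdSymplecticForm (fderiv ℝ inversion (extChartAt (𝓡 4) p x.1 - extChartAt (𝓡 4) p p)
          (mfderiv (𝓡 4) 𝓘(ℝ, EuclideanSpace ℝ (Fin 4))
            (fun z : punctured p => extChartAt (𝓡 4) p z.1) x v)) b)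
    {u : ℂ → punctured p} {z : ℂ} (hu : MDifferentiableAt 𝓘(ℝ, ℂ) (𝓡 4) u z)
    (hhol : IsJHolomorphic (𝓡 4) J u) (hz : InPuncturedChartBall p ε' (u z))
    (π : EuclideanSpace ℝ (Fin 4) →L[ℝ] ℂ)
    (hπ : ∀ a, π (stdComplexStructure a) = Complex.I * π a) :
    DifferentiableAt ℂ
      (fun w : ℂ => π (inversion (extChartAt (𝓡 4) p (u w).1 - extChartAt (𝓡 4) p p))) z := by
  have hW := hasFDerivAt_inversion_extChartAt_curve p hu hz.1
  refine differentiableAt_complex_of_hasFDerivAt (π.hasFDerivAt.comp z hW) fun ζ => ?_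
  change π (fderiv ℝ inversion (extChartAt (𝓡 4) p (u z).1 - extChartAt (𝓡 4) p p)
      (mfderiv (𝓡 4) 𝓘(ℝ, EuclideanSpace ℝ (Fin 4))
        (fun y : punctured p => extChartAt (𝓡 4) p y.1) (u z)
          (mfderiv 𝓘(ℝ, ℂ) (𝓡 4) u z (Complex.I * ζ : ℂ)))) =
    Complex.I * π (fderiv ℝ inversion (extChartAt (𝓡 4) p (u z).1 - extChartAt (𝓡 4) p p)
      (mfderiv (𝓡 4) 𝓘(ℝ, EuclideanSpace ℝ (Fin 4))
        (fun y : punctured p => extChartAt (𝓡 4) p y.1) (u z)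
          (mfderiv 𝓘(ℝ, ℂ) (𝓡 4) u z (ζ : ℂ))))
  rw [hhol z ζ, eq_stdComplexStructure_of_forall_inner_eq (hJstd (u z) hz _), hπ]

/-- **Collar Liouville** on a `C^∞` `4`-manifold `M`: given the flat Liouville theorem for
bounded continuous locally sub-mean-value functions (`hL`), a field `J` standard on the punctured
chart-ball `B_ε'` at `p` with `closedBall (e p) ε' ⊆ e.target`, and a non-constant `C^∞`
`J`-holomorphic `u : ℂ → M ∖ {p}` avoiding some punctured chart-ball `B_η`, the curve `u` avoids
`B_ε'`. See the module docstring for the proof. -/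
theorem collarLiouville_of_subMeanValueLiouville
    (hL : ∀ (s : ℂ → ℝ), Continuous s → BddAbove (range s) →
      (∀ z : ℂ, ∃ r₀ : ℝ, 0 < r₀ ∧ ∀ r ∈ Ioo 0 r₀, s z ≤ Real.circleAverage s z r) →
      ∀ z w : ℂ, s z = s w)
    (p : M) (J : ∀ x : punctured p, TangentSpace (𝓡 4) x →L[ℝ] TangentSpace (𝓡 4) x) {ε' : ℝ}
    (hball : Metric.closedBall (extChartAt (𝓡 4) p p) ε' ⊆ (extChartAt (𝓡 4) p).target)
    (hJstd : ∀ x : punctured p, InPuncturedChartBall p ε' x →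
      ∀ (v : TangentSpace (𝓡 4) x) (b : EuclideanSpace ℝ (Fin 4)),
        inner ℝ (fderiv ℝ inversion (extChartAt (𝓡 4) p x.1 - extChartAt (𝓡 4) p p)
          (mfderiv (𝓡 4) 𝓘(ℝ, EuclideanSpace ℝ (Fin 4))
            (fun z : punctured p => extChartAt (𝓡 4) p z.1) x (J x v))) b
        = stdSymplecticForm (fderiv ℝ inversion (extChartAt (𝓡 4) p x.1 - extChartAt (𝓡 4) p p)
          (mfderiv (𝓡 4) 𝓘(ℝ, EuclideanSpace ℝ (Fin 4))
            (fun z : punctured p => extChartAt (𝓡 4) p z.1) x v)) b)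
    {u : ℂ → punctured p} (hu : ContMDiff 𝓘(ℝ, ℂ) (𝓡 4) ∞ u) (hne : ∃ z z' : ℂ, u z ≠ u z')
    (hhol : IsJHolomorphic (𝓡 4) J u)
    (havoid : ∃ η : ℝ, 0 < η ∧ ∀ z : ℂ, ¬ InPuncturedChartBall p η (u z)) (z : ℂ) :
    ¬ InPuncturedChartBall p ε' (u z) := by
  classical
  intro hz₁
  obtain ⟨η, hη, havoid⟩ := havoid
  -- the two complex coordinates of `ℝ⁴ = ℂ²`
  obtain ⟨π₁, hπ₁⟩ := exists_clm_coordPair 0 1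
  obtain ⟨π₂, hπ₂⟩ := exists_clm_coordPair 2 3
  have hπ₁J : ∀ a, π₁ (stdComplexStructure a) = Complex.I * π₁ a := fun a => by
    rw [hπ₁, hπ₁, coordPair_stdComplexStructure_zero_one]
  have hπ₂J : ∀ a, π₂ (stdComplexStructure a) = Complex.I * π₂ a := fun a => by
    rw [hπ₂, hπ₂, coordPair_stdComplexStructure_two_three]
  have hnorm : ∀ a, ‖a‖ ^ 2 = ‖π₁ a‖ ^ 2 + ‖π₂ a‖ ^ 2 := fun a => by
    rw [hπ₁, hπ₂, norm_sq_eq_coordPair]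
  -- `Ω = u⁻¹(B_ε')` and `W = ι(e u − e p)`
  set Ω : Set ℂ := {w | InPuncturedChartBall p ε' (u w)} with hΩ_def
  set W : ℂ → EuclideanSpace ℝ (Fin 4) :=
    fun w => inversion (extChartAt (𝓡 4) p (u w).1 - extChartAt (𝓡 4) p p) with hW_def
  have hz₁' : z ∈ Ω := hz₁
  have hΩo : IsOpen Ω := (isOpen_setOf_inPuncturedChartBall p ε').preimage hu.continuous
  have hud : ∀ w, MDifferentiableAt 𝓘(ℝ, ℂ) (𝓡 4) u w := fun w => hu.mdifferentiableAt (by simp)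
  have hWd : ∀ w, (u w).1 ∈ (chartAt (EuclideanSpace ℝ (Fin 4)) p).source →
      DifferentiableAt ℝ W w := fun w hw =>
    (hasFDerivAt_inversion_extChartAt_curve p (hud w) hw).differentiableAt
  have hg₁ : ∀ w ∈ Ω, DifferentiableAt ℂ (fun w => π₁ (W w)) w := fun w hw =>
    differentiableAt_coordPair_inversion_extChartAt_curve p hJstd (hud w) hhol hw π₁ hπ₁J
  have hg₂ : ∀ w ∈ Ω, DifferentiableAt ℂ (fun w => π₂ (W w)) w := fun w hw =>
    differentiableAt_coordPair_inversion_extChartAt_curve p hJstd (hud w) hhol hw π₂ hπ₂J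
  -- the size of `W`: `ε'⁻² < ‖W‖² ≤ η⁻²` on `Ω`, `‖W‖² = ε'⁻²` on `∂Ω`
  have hWn : ∀ w, ‖W w‖ = ‖extChartAt (𝓡 4) p (u w).1 - extChartAt (𝓡 4) p p‖⁻¹ := fun w =>
    norm_inversion _
  have hlow : ∀ w ∈ Ω, (ε'⁻¹) ^ 2 < ‖W w‖ ^ 2 := fun w hw =>
    lt_norm_sq_inversion (norm_pos_iff.2 (extChartAt_sub_ne_zero p hw.1))
      (by rw [← dist_eq_norm]; exact Metric.mem_ball.1 hw.2)
  have hup : ∀ w ∈ Ω, ‖W w‖ ^ 2 ≤ (η⁻¹) ^ 2 := fun w hw => by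
    have hηle : η ≤ ‖extChartAt (𝓡 4) p (u w).1 - extChartAt (𝓡 4) p p‖ := by
      by_contra hlt
      push Not at hlt
      exact havoid w ⟨hw.1, Metric.mem_ball.2 (by rwa [dist_eq_norm])⟩
    rw [hWn w]
    exact pow_le_pow_left₀ (inv_nonneg.2 (norm_nonneg _)) (inv_anti₀ hη hηle) 2
  have hfront : ∀ w ∈ frontier Ω, ‖W w‖ ^ 2 = (ε'⁻¹) ^ 2 := fun w hw => by
    rw [hWn w, (norm_extChartAt_sub_eq_of_mem_frontier p hball hu.continuous hw).2]
  have hclos : ∀ w ∈ closure Ω, (u w).1 ∈ (chartAt (EuclideanSpace ℝ (Fin 4)) p).source := by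
    intro w hw
    by_cases hwΩ : w ∈ Ω
    · exact hwΩ.1
    · have hw' : w ∈ frontier Ω := by
        rw [hΩo.frontier_eq]
        exact ⟨hw, hwΩ⟩
      exact (norm_extChartAt_sub_eq_of_mem_frontier p hball hu.continuous hw').1
  -- the comparison function `s`
  set s : ℂ → ℝ := Ω.piecewise (fun w => ‖W w‖ ^ 2) (fun _ => (ε'⁻¹) ^ 2) with hs_def
  have hs_in : ∀ w ∈ Ω, s w = ‖W w‖ ^ 2 := fun w hw => piecewise_eq_of_mem _ _ _ hw
  have hs_out : ∀ w ∉ Ω, s w = (ε'⁻¹) ^ 2 := fun w hw => piecewise_eq_of_notMem _ _ _ hw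
  have hs_ge : ∀ w, (ε'⁻¹) ^ 2 ≤ s w := fun w => by
    by_cases hw : w ∈ Ω
    · rw [hs_in w hw]
      exact (hlow w hw).le
    · rw [hs_out w hw]
  have hs_le : ∀ w, s w ≤ max ((η⁻¹) ^ 2) ((ε'⁻¹) ^ 2) := fun w => by
    by_cases hw : w ∈ Ω
    · rw [hs_in w hw]
      exact (hup w hw).trans (le_max_left _ _)
    · rw [hs_out w hw]
      exact le_max_right _ _
  have hsc : Continuous s := by
    refine continuous_piecewise hfront (fun w hw => ?_) continuousOn_const
    exact ((hWd w (hclos w hw)).continuousAt.norm.pow 2).continuousWithinAt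
  have hsci : ∀ (c : ℂ) (R : ℝ), CircleIntegrable s c R := fun c R =>
    hsc.continuousOn.circleIntegrable'
  -- `s` has the local sub-mean-value property
  have hsmv : ∀ w : ℂ, ∃ r₀ : ℝ, 0 < r₀ ∧ ∀ r ∈ Ioo 0 r₀, s w ≤ Real.circleAverage s w r := by
    intro w
    by_cases hw : w ∈ Ω
    · obtain ⟨r₀, hr₀, hsub⟩ := Metric.isOpen_iff.1 hΩo w hw
      refine ⟨r₀, hr₀, fun r hr => ?_⟩
      have hcb : Metric.closedBall w r ⊆ Ω := (Metric.closedBall_subset_ball hr.2).trans hsub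
      have hsph' : Metric.sphere w |r| ⊆ Metric.closedBall w r := by
        rw [abs_of_pos hr.1]
        exact Metric.sphere_subset_closedBall
      have hsph : Metric.sphere w |r| ⊆ Ω := hsph'.trans hcb
      have hd₁ : DifferentiableOn ℂ (fun w => π₁ (W w)) Ω := fun x hx =>
        (hg₁ x hx).differentiableWithinAt
      have hd₂ : DifferentiableOn ℂ (fun w => π₂ (W w)) Ω := fun x hx =>
        (hg₂ x hx).differentiableWithinAt
      have ha₁ : AnalyticOnNhd ℂ (fun w => π₁ (W w)) (Metric.closedBall w r) :=
        (hd₁.analyticOnNhd hΩo).mono hcb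
      have ha₂ : AnalyticOnNhd ℂ (fun w => π₂ (W w)) (Metric.closedBall w r) :=
        (hd₂.analyticOnNhd hΩo).mono hcb
      have h₁ := norm_sq_le_circleAverage hr.1 ha₁
      have h₂ := norm_sq_le_circleAverage hr.1 ha₂
      have hci₁ : CircleIntegrable (fun x => ‖π₁ (W x)‖ ^ 2) w r :=
        ((ha₁.continuousOn.norm.pow 2).mono hsph').circleIntegrable'
      have hci₂ : CircleIntegrable (fun x => ‖π₂ (W x)‖ ^ 2) w r :=
        ((ha₂.continuousOn.norm.pow 2).mono hsph').circleIntegrable'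
      have hfun : (fun x => ‖π₁ (W x)‖ ^ 2 + ‖π₂ (W x)‖ ^ 2) = fun x => ‖W x‖ ^ 2 :=
        funext fun x => (hnorm (W x)).symm
      calc s w = ‖W w‖ ^ 2 := hs_in w hw
        _ = ‖π₁ (W w)‖ ^ 2 + ‖π₂ (W w)‖ ^ 2 := hnorm _
        _ ≤ Real.circleAverage (fun x => ‖π₁ (W x)‖ ^ 2) w r +
              Real.circleAverage (fun x => ‖π₂ (W x)‖ ^ 2) w r := add_le_add h₁ h₂
        _ = Real.circleAverage (fun x => ‖π₁ (W x)‖ ^ 2 + ‖π₂ (W x)‖ ^ 2) w r :=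
              (Real.circleAverage_fun_add hci₁ hci₂).symm
        _ = Real.circleAverage (fun x => ‖W x‖ ^ 2) w r := by rw [hfun]
        _ = Real.circleAverage s w r :=
              Real.circleAverage_congr_sphere fun x hx => (hs_in x (hsph hx)).symm
    · refine ⟨1, one_pos, fun r _ => ?_⟩
      calc s w = (ε'⁻¹) ^ 2 := hs_out w hw
        _ = Real.circleAverage (fun _ => (ε'⁻¹) ^ 2) w r := (Real.circleAverage_const _ _ _).symm
        _ ≤ Real.circleAverage s w r :=
              Real.circleAverage_mono (circleIntegrable_const _ _ _) (hsci w r) fun x _ => hs_ge x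
  -- by the flat Liouville theorem `s` is constant; as `z ∈ Ω`, `Ω = ℂ`
  have hconst := hL s hsc ⟨max ((η⁻¹) ^ 2) ((ε'⁻¹) ^ 2), by
    rintro _ ⟨w, rfl⟩
    exact hs_le w⟩ hsmv
  have hall : ∀ w, w ∈ Ω := fun w => by
    by_contra hw
    have h := hconst w z
    rw [hs_out w hw, hs_in z hz₁'] at h
    exact (hlow z hz₁').ne h
  -- the complex coordinates of `W` are bounded entire functions, hence constant (Liouville)
  have hbd : ∀ π : EuclideanSpace ℝ (Fin 4) →L[ℝ] ℂ, (∀ a, ‖π a‖ ^ 2 ≤ ‖a‖ ^ 2) →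
      (∀ w ∈ Ω, DifferentiableAt ℂ (fun w => π (W w)) w) → ∀ x y, π (W x) = π (W y) := by
    intro π hπle hπd x y
    have hD : Differentiable ℂ (fun w => π (W w)) := fun w => hπd w (hall w)
    refine hD.apply_eq_apply_of_bounded ?_ x y
    rw [isBounded_iff_forall_norm_le]
    refine ⟨η⁻¹, ?_⟩
    rintro _ ⟨w, rfl⟩
    have h1 : ‖π (W w)‖ ^ 2 ≤ (η⁻¹) ^ 2 := (hπle _).trans (hup w (hall w))
    exact (pow_le_pow_iff_left₀ (norm_nonneg _) (inv_nonneg.2 hη.le) two_ne_zero).1 h1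
  have hπ₁le : ∀ a, ‖π₁ a‖ ^ 2 ≤ ‖a‖ ^ 2 := fun a => by
    rw [hnorm a]
    exact le_add_of_nonneg_right (sq_nonneg _)
  have hπ₂le : ∀ a, ‖π₂ a‖ ^ 2 ≤ ‖a‖ ^ 2 := fun a => by
    rw [hnorm a]
    exact le_add_of_nonneg_left (sq_nonneg _)
  have hc₁ := hbd π₁ hπ₁le hg₁
  have hc₂ := hbd π₂ hπ₂le hg₂
  have hWc : ∀ x y, W x = W y := fun x y => by
    have h0 : ‖W x - W y‖ ^ 2 = 0 := by
      rw [hnorm, map_sub, map_sub, hc₁ x y, hc₂ x y, sub_self, sub_self, norm_zero]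
      ring
    rwa [sq_eq_zero_iff, norm_eq_zero, sub_eq_zero] at h0
  -- hence `e ∘ u` is constant and `u` is constant: a contradiction
  obtain ⟨x, y, hxy⟩ := hne
  apply hxy
  have h1 : extChartAt (𝓡 4) p (u x).1 - extChartAt (𝓡 4) p p =
      extChartAt (𝓡 4) p (u y).1 - extChartAt (𝓡 4) p p := inversion_injective (hWc x y)
  have h2 : extChartAt (𝓡 4) p (u x).1 = extChartAt (𝓡 4) p (u y).1 := sub_left_inj.1 h1
  have hsx : (u x).1 ∈ (extChartAt (𝓡 4) p).source := by
    rw [extChartAt_source]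
    exact (hall x).1
  have hsy : (u y).1 ∈ (extChartAt (𝓡 4) p).source := by
    rw [extChartAt_source]
    exact (hall y).1
  exact Subtype.ext ((extChartAt (𝓡 4) p).injOn hsx hsy h2)

end Manifold

/-! ### The registered stub -/

/-- **Stub (P1) — collar Liouville / bubble confinement** (registered stub of line `Sketch`,
crux `HyperbolicEnd`; after the first hypothesis it is verbatim the registered stub
`stub_bubbleConfinement` of the sibling crux `WitnessCharge`). Assume the flat Liouville theorem
for sub-mean-value functions. Let `J` be standard on the punctured chart-ball `B_ε'` at `p`
(`⟪Dι De (J v), b⟫ = ω₀(Dι De v, b)`) with `closedBall (e p) ε' ⊆ e.target`. Then a non-constant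
`C^∞` `J`-holomorphic `u : ℂ → Σ ∖ p` whose image avoids some punctured chart-ball `B_η` avoids
the whole collar `B_ε'` (`collarLiouville_of_subMeanValueLiouville` for `M = Σ`). -/
theorem stub_collarLiouville :
    (∀ (s : ℂ → ℝ), Continuous s → BddAbove (range s) →
      (∀ z : ℂ, ∃ r₀ : ℝ, 0 < r₀ ∧ ∀ r ∈ Ioo 0 r₀, s z ≤ Real.circleAverage s z r) →
      ∀ z w : ℂ, s z = s w) →
    ∀ (S : HomotopySphere 4) (p : S.carrier)
      (J : ∀ x : punctured p, TangentSpace (𝓡 4) x →L[ℝ] TangentSpace (𝓡 4) x) (ε' : ℝ),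
      0 < ε' →
      Metric.closedBall (extChartAt (𝓡 4) p p) ε' ⊆ (extChartAt (𝓡 4) p).target →
      (∀ x : punctured p, InPuncturedChartBall p ε' x →
        ∀ (v : TangentSpace (𝓡 4) x) (b : EuclideanSpace ℝ (Fin 4)),
          inner ℝ (fderiv ℝ inversion (extChartAt (𝓡 4) p x.1 - extChartAt (𝓡 4) p p)
            (mfderiv (𝓡 4) 𝓘(ℝ, EuclideanSpace ℝ (Fin 4))
              (fun z : punctured p => extChartAt (𝓡 4) p z.1) x (J x v))) b
          = stdSymplecticForm (fderiv ℝ inversion (extChartAt (𝓡 4) p x.1 - extChartAt (𝓡 4) p p)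
            (mfderiv (𝓡 4) 𝓘(ℝ, EuclideanSpace ℝ (Fin 4))
              (fun z : punctured p => extChartAt (𝓡 4) p z.1) x v)) b) →
      ∀ (u : ℂ → punctured p), ContMDiff 𝓘(ℝ, ℂ) (𝓡 4) ∞ u → (∃ z z' : ℂ, u z ≠ u z') →
        IsJHolomorphic (𝓡 4) J u →
        (∃ η : ℝ, 0 < η ∧ ∀ z : ℂ, ¬ InPuncturedChartBall p η (u z)) →
        ∀ z : ℂ, ¬ InPuncturedChartBall p ε' (u z) := by
  intro hL S p J ε' _hε' hball hJstd u hu hne hhol havoid z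
  exact collarLiouville_of_subMeanValueLiouville hL p J hball hJstd hu hne hhol havoid z

end Summit.SmoothPoincare4.SmoothPoincare4.Cruxes.HyperbolicEnd.Sketch

end
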